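import Literature.Probability.LatticeModels.AnisotropicLatticeSum
import Literature.Probability.LatticeModels.TorusFourierAnisotropicDecay
import HarnessLib

/-!
# Anisotropic lattice sums on the space-time torus `(ℤ/Pℤ) × (ℤ/Lℤ)²` (the `L¹` norm of a finite-volume sector propagator)

Topic `Literature/Probability/LatticeModels`; the finite-volume form of `AnisotropicLatticeSum.lean`.  On the space-time
torus of a lattice fermion model at positive temperature — `P = 2M` imaginary-time slices times the spatial torus
`(ℤ/Lℤ)²` — the decay factor of a single-scale anisotropic sector propagator delivered by the discrete integration by
parts (`TorusFourierAnisotropicDecay.lean`) is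

  `D(j, z) = (1 + s₀|j̃| + s₁(|z̃₁| + |z̃₂|) + s₂|ã_{v⊥}(z)| + s₃|ã_v(z)|)⁻¹`,

`j̃`, `z̃ᵢ` the centred coordinates, `v = (v₁, v₂)` an integer approximant of the tangent direction of the sector,
`v⊥ = (-v₂, v₁)`, and `ã_w(z) = valMinAbs (w₁z₁ + w₂z₂)` the decay variable dual to the step `w` — equal to the
coordinate `w·z̃` only in the NEAR REGION `2(|v₁|+|v₂|)|z̃|_∞ < L`.  This file bounds the lattice sum `Σ_{(j,z)} D^m`
(`m ≥ 6`) by the product of the three "volumes" `s₀⁻¹ · (s₂|v|)⁻¹ · (s₃|v|)⁻¹` plus a far-region term that is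
negligible for `L` large (`(1 + s₁R₀)^{-(m-6)}`, `R₀ ≈ L/(2|v|₁)` the near radius):

* `inv_pow_le_inv_pow_mul` — `x^{-m} ≤ y^{-m₁} z^{-m₂}` for `1 ≤ y, z ≤ x`, `m₁ + m₂ ≤ m` (splitting a decay factor);
* `sum_inv_pow_cyclic_le` — the time factor `Σ_{j ∈ ℤ/Pℤ} (1 + s|j̃|)^{-3} ≤ 32(1/s + 1)`;
* `sum_inv_pow_torus_l1_le` — the isotropic plane factor `Σ_{z ∈ (ℤ/Lℤ)²} (1 + s(|z̃₁|+|z̃₂|))^{-3} ≤ 32(1/s + 1)²`;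
* `sum_inv_pow_torus_near_le` — the near region through the rotated frame `(v⊥, v)/|v|` and `sum_inv_pow_frame_le`:
  `Σ_{|z̃|_∞ ≤ R₀} (1 + s₂|v⊥·z̃| + s₃|v·z̃|)^{-3} ≤ 8(2√2/(s₂|v|) + 2)(2√2/(s₃|v|) + 2)`;
* **`sum_inv_pow_spaceTimeTorus_le`** — the assembled bound, uniformly in `P` and `L`:
  `Σ_{(j,z)} D(j,z)^m ≤ 32(1/s₀+1) · [8(2√2/(s₂|v|)+2)(2√2/(s₃|v|)+2) + (1+s₁R₀)^{-(m-6)} · 32(1/s₁+1)²]`.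

With the rates of a sector at scale `h` (`s₀ ≍ γ^h β/P`, `s₁ ≍ γ^h`, `s₂|v| ≍ γ^h`, `s₃|v| ≍ γ^{h/2}`) and the time
weight `β/P` this is the `γ^{-h} · γ^{-h} · γ^{-h/2}` volume of Benfatto–Giuliani–Mastropietro 2006, (2.81), at finite
`(β, L)`.

Everything is proved; no definitions, no named facts. [folklore]

## Sources

G. Benfatto, A. Giuliani, V. Mastropietro, Ann. Henri Poincaré 7 (2006) 809–898, §2.6 (2.81), Lemma 2.2 and footnote ¹
(`BenfattoGiulianiMastropietro2006`).  Routine ("folklore").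
-/

noncomputable section

open Finset
open scoped Real

namespace Literature.Probability.LatticeModels

/-! ### Splitting a decay factor -/

/-- **Splitting a decay factor**: if `1 ≤ y ≤ x` and `1 ≤ z ≤ x` then `x^{-m} ≤ y^{-m₁} z^{-m₂}` whenever `m₁ + m₂ ≤ m`
(used with `x = 1 + a + b`, `y = 1 + a`, `z = 1 + b`). [folklore] -/
theorem inv_pow_le_inv_pow_mul {x y z : ℝ} (hy : 1 ≤ y) (hz : 1 ≤ z) (hxy : y ≤ x) (hxz : z ≤ x) {m m₁ m₂ : ℕ}
    (hm : m₁ + m₂ ≤ m) : x⁻¹ ^ m ≤ y⁻¹ ^ m₁ * z⁻¹ ^ m₂ := by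
  have hx : 1 ≤ x := hy.trans hxy
  have h1 : x⁻¹ ≤ 1 := inv_le_one_of_one_le₀ hx
  have h0 : 0 ≤ x⁻¹ := inv_nonneg.2 (zero_le_one.trans hx)
  calc x⁻¹ ^ m ≤ x⁻¹ ^ (m₁ + m₂) := pow_le_pow_of_le_one h0 h1 hm
    _ = x⁻¹ ^ m₁ * x⁻¹ ^ m₂ := pow_add _ _ _
    _ ≤ y⁻¹ ^ m₁ * z⁻¹ ^ m₂ :=
        mul_le_mul (pow_le_pow_left₀ h0 (inv_anti₀ (by linarith) hxy) _)
          (pow_le_pow_left₀ h0 (inv_anti₀ (by linarith) hxz) _) (by positivity) (by positivity)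

/-- One factor only: `x^{-m} ≤ z^{-m₂}` for `1 ≤ z ≤ x`, `m₂ ≤ m`. [folklore] -/
theorem inv_pow_le_inv_pow_of_le {x z : ℝ} (hz : 1 ≤ z) (hxz : z ≤ x) {m m₂ : ℕ} (hm : m₂ ≤ m) : x⁻¹ ^ m ≤ z⁻¹ ^ m₂ := by
  have h := inv_pow_le_inv_pow_mul le_rfl hz (hz.trans hxz) hxz (m₁ := 0) (by simpa using hm)
  simpa using h

/-! ### The time factor -/

/-- Counting time slices: `#{j ∈ (ℤ/Pℤ)¹ : 1 + s|j̃| ≤ R} ≤ 4(1/s + 1) R²` for `R ≥ 1`. [folklore] -/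
theorem card_filter_cyclic_le {P : ℕ} [NeZero P] {s : ℝ} (hs : 0 < s) {R : ℝ} (hR : 1 ≤ R) :
    (((univ.filter fun j : TorusSite 1 P => 1 + s * |(((j 0).valMinAbs : ℤ) : ℝ)| ≤ R).card : ℕ) : ℝ) ≤
      4 * (1 / s + 1) * R ^ 2 := by
  have hsep : ∀ a b : TorusSite 1 P, |(((a 0).valMinAbs : ℤ) : ℝ) - (((b 0).valMinAbs : ℤ) : ℝ)| < 1 →
      |(0 : ℝ) - 0| < 1 → a = b := by
    intro a b h _
    exact funext fun i => by rw [Subsingleton.elim i 0]; exact valMinAbs_eq_of_abs_sub_lt _ _ h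
  have hcount := card_filter_abs_le_le_of_separated (fun j : TorusSite 1 P => (((j 0).valMinAbs : ℤ) : ℝ))
    (fun _ => (0 : ℝ)) one_pos hsep (div_nonneg (by linarith) hs.le : (0 : ℝ) ≤ (R - 1) / s) le_rfl
  have hsub : (univ.filter fun j : TorusSite 1 P => 1 + s * |(((j 0).valMinAbs : ℤ) : ℝ)| ≤ R) ⊆
      univ.filter fun j : TorusSite 1 P => |(((j 0).valMinAbs : ℤ) : ℝ)| ≤ (R - 1) / s ∧ |(0 : ℝ)| ≤ 0 := by
    intro j hj
    have h := (mem_filter.1 hj).2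
    refine mem_filter.2 ⟨mem_univ _, ?_, by simp⟩
    rw [le_div_iff₀ hs]; linarith
  calc (((univ.filter fun j : TorusSite 1 P => 1 + s * |(((j 0).valMinAbs : ℤ) : ℝ)| ≤ R).card : ℕ) : ℝ)
      ≤ (((univ.filter fun j : TorusSite 1 P => |(((j 0).valMinAbs : ℤ) : ℝ)| ≤ (R - 1) / s ∧ |(0 : ℝ)| ≤ 0).card : ℕ) : ℝ) := by
        exact_mod_cast card_le_card hsub
    _ ≤ (2 * ((R - 1) / s) / 1 + 2) * (2 * 0 / 1 + 2) := hcount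
    _ = 4 * ((R - 1) / s + 1) := by ring
    _ ≤ 4 * (1 / s + 1) * R ^ 2 := by
        have h1 : (R - 1) / s ≤ R ^ 2 / s := div_le_div_of_nonneg_right (by nlinarith) hs.le
        have h2 : (1 : ℝ) ≤ R ^ 2 := by nlinarith
        calc 4 * ((R - 1) / s + 1) ≤ 4 * (R ^ 2 / s + R ^ 2) := by linarith
          _ = 4 * (1 / s + 1) * R ^ 2 := by ring

/-- **The time factor**: `Σ_{j ∈ (ℤ/Pℤ)¹} (1 + s|j̃|)^{-3} ≤ 32(1/s + 1)`. [folklore] -/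
theorem sum_inv_pow_cyclic_le {P : ℕ} [NeZero P] {s : ℝ} (hs : 0 < s) {m : ℕ} (hm : 3 ≤ m) :
    ∑ j : TorusSite 1 P, (1 + s * |(((j 0).valMinAbs : ℤ) : ℝ)|)⁻¹ ^ m ≤ 32 * (1 / s + 1) := by
  have h := sum_inv_pow_le_of_card_le (fun j : TorusSite 1 P => 1 + s * |(((j 0).valMinAbs : ℤ) : ℝ)|)
    (fun j => le_add_of_nonneg_right (by positivity)) (by positivity : (0 : ℝ) ≤ 4 * (1 / s + 1))
    (fun R hR => card_filter_cyclic_le hs hR) hm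
  linarith

/-! ### The isotropic plane factor -/

/-- Counting torus sites: `#{z ∈ (ℤ/Lℤ)² : 1 + s(|z̃₁| + |z̃₂|) ≤ R} ≤ 4(1/s + 1)² R²` for `R ≥ 1`. [folklore] -/
theorem card_filter_torus_l1_le {L : ℕ} [NeZero L] {s : ℝ} (hs : 0 < s) {R : ℝ} (hR : 1 ≤ R) :
    (((univ.filter fun z : TorusSite 2 L =>
        1 + s * (|(((z 0).valMinAbs : ℤ) : ℝ)| + |(((z 1).valMinAbs : ℤ) : ℝ)|) ≤ R).card : ℕ) : ℝ) ≤
      4 * (1 / s + 1) ^ 2 * R ^ 2 := by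
  have hsep : ∀ a b : TorusSite 2 L, |(((a 0).valMinAbs : ℤ) : ℝ) - (((b 0).valMinAbs : ℤ) : ℝ)| < 1 →
      |(((a 1).valMinAbs : ℤ) : ℝ) - (((b 1).valMinAbs : ℤ) : ℝ)| < 1 → a = b := by
    intro a b h0 h1
    have e0 := valMinAbs_eq_of_abs_sub_lt _ _ h0
    have e1 := valMinAbs_eq_of_abs_sub_lt _ _ h1
    exact funext fun i => by fin_cases i <;> assumption
  have hB : (0 : ℝ) ≤ (R - 1) / s := div_nonneg (by linarith) hs.le
  have hcount := card_filter_abs_le_le_of_separated (fun z : TorusSite 2 L => (((z 0).valMinAbs : ℤ) : ℝ))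
    (fun z => (((z 1).valMinAbs : ℤ) : ℝ)) one_pos hsep hB hB
  have hsub : (univ.filter fun z : TorusSite 2 L =>
      1 + s * (|(((z 0).valMinAbs : ℤ) : ℝ)| + |(((z 1).valMinAbs : ℤ) : ℝ)|) ≤ R) ⊆
      univ.filter fun z : TorusSite 2 L => |(((z 0).valMinAbs : ℤ) : ℝ)| ≤ (R - 1) / s ∧
        |(((z 1).valMinAbs : ℤ) : ℝ)| ≤ (R - 1) / s := by
    intro z hz
    have h := (mem_filter.1 hz).2
    have ha := abs_nonneg (((z 0).valMinAbs : ℤ) : ℝ)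
    have hb := abs_nonneg (((z 1).valMinAbs : ℤ) : ℝ)
    refine mem_filter.2 ⟨mem_univ _, ?_, ?_⟩
    · rw [le_div_iff₀ hs]; nlinarith
    · rw [le_div_iff₀ hs]; nlinarith
  calc (((univ.filter fun z : TorusSite 2 L =>
        1 + s * (|(((z 0).valMinAbs : ℤ) : ℝ)| + |(((z 1).valMinAbs : ℤ) : ℝ)|) ≤ R).card : ℕ) : ℝ)
      ≤ (((univ.filter fun z : TorusSite 2 L => |(((z 0).valMinAbs : ℤ) : ℝ)| ≤ (R - 1) / s ∧
          |(((z 1).valMinAbs : ℤ) : ℝ)| ≤ (R - 1) / s).card : ℕ) : ℝ) := by exact_mod_cast card_le_card hsub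
    _ ≤ (2 * ((R - 1) / s) / 1 + 2) * (2 * ((R - 1) / s) / 1 + 2) := hcount
    _ = 4 * ((R - 1) / s + 1) ^ 2 := by ring
    _ ≤ 4 * (1 / s + 1) ^ 2 * R ^ 2 := by
        have h1 : (R - 1) / s ≤ R / s := div_le_div_of_nonneg_right (by linarith) hs.le
        have h3 : 0 ≤ (R - 1) / s + 1 := by linarith
        have h4 : (R - 1) / s + 1 ≤ (1 / s + 1) * R := by
          calc (R - 1) / s + 1 ≤ R / s + R := by linarith
            _ = (1 / s + 1) * R := by ring
        calc 4 * ((R - 1) / s + 1) ^ 2 ≤ 4 * ((1 / s + 1) * R) ^ 2 := by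
              exact mul_le_mul_of_nonneg_left (pow_le_pow_left₀ h3 h4 2) (by norm_num)
          _ = 4 * (1 / s + 1) ^ 2 * R ^ 2 := by ring

/-- **The isotropic plane factor**: `Σ_{z ∈ (ℤ/Lℤ)²} (1 + s(|z̃₁| + |z̃₂|))^{-3} ≤ 32(1/s + 1)²`. [folklore] -/
theorem sum_inv_pow_torus_l1_le {L : ℕ} [NeZero L] {s : ℝ} (hs : 0 < s) {m : ℕ} (hm : 3 ≤ m) :
    ∑ z : TorusSite 2 L, (1 + s * (|(((z 0).valMinAbs : ℤ) : ℝ)| + |(((z 1).valMinAbs : ℤ) : ℝ)|))⁻¹ ^ m ≤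
      32 * (1 / s + 1) ^ 2 := by
  have h := sum_inv_pow_le_of_card_le
    (fun z : TorusSite 2 L => 1 + s * (|(((z 0).valMinAbs : ℤ) : ℝ)| + |(((z 1).valMinAbs : ℤ) : ℝ)|))
    (fun z => le_add_of_nonneg_right (by positivity)) (by positivity : (0 : ℝ) ≤ 4 * (1 / s + 1) ^ 2)
    (fun R hR => card_filter_torus_l1_le hs hR) hm
  linarith

/-! ### The near region through the rotated integer frame -/

/-- **The near region**: for an integer vector `v ≠ 0`, `v⊥ = (-v₂, v₁)`, rates `s₂, s₃ > 0` and any finite set `S` of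
torus sites, `Σ_{z ∈ S} (1 + s₂|v⊥·z̃| + s₃|v·z̃|)^{-3} ≤ 8(2√2/(s₂|v|) + 2)(2√2/(s₃|v|) + 2)` (the centred coordinates
`z ↦ z̃ ∈ ℤ²` are injective, and `(v⊥, v)/|v|` is an orthonormal frame). [folklore] -/
theorem sum_inv_pow_torus_near_le {L : ℕ} [NeZero L] (S : Finset (TorusSite 2 L)) (v : Fin 2 → ℤ) (hv : v ≠ 0)
    {s₂ s₃ : ℝ} (hs₂ : 0 < s₂) (hs₃ : 0 < s₃) {m : ℕ} (hm : 3 ≤ m) :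
    ∑ z ∈ S, (1 + s₂ * |(-(v 1 : ℝ)) * (((z 0).valMinAbs : ℤ) : ℝ) + (v 0 : ℝ) * (((z 1).valMinAbs : ℤ) : ℝ)|
        + s₃ * |(v 0 : ℝ) * (((z 0).valMinAbs : ℤ) : ℝ) + (v 1 : ℝ) * (((z 1).valMinAbs : ℤ) : ℝ)|)⁻¹ ^ m ≤
      8 * ((2 * Real.sqrt 2 / (s₂ * Real.sqrt ((v 0 : ℝ) ^ 2 + (v 1 : ℝ) ^ 2)) + 2) *
        (2 * Real.sqrt 2 / (s₃ * Real.sqrt ((v 0 : ℝ) ^ 2 + (v 1 : ℝ) ^ 2)) + 2)) := by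
  -- `|v| > 0`
  have hv2 : (0 : ℝ) < (v 0 : ℝ) ^ 2 + (v 1 : ℝ) ^ 2 := by
    by_contra h
    have h0 : (v 0 : ℝ) = 0 := by nlinarith [sq_nonneg (v 0 : ℝ), sq_nonneg (v 1 : ℝ)]
    have h1 : (v 1 : ℝ) = 0 := by nlinarith [sq_nonneg (v 0 : ℝ), sq_nonneg (v 1 : ℝ)]
    have h0' : v 0 = 0 := by exact_mod_cast h0
    have h1' : v 1 = 0 := by exact_mod_cast h1
    exact hv (funext fun i => by fin_cases i <;> assumption)
  set r : ℝ := Real.sqrt ((v 0 : ℝ) ^ 2 + (v 1 : ℝ) ^ 2) with hr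
  have hrpos : 0 < r := Real.sqrt_pos.2 hv2
  have hrsq : r ^ 2 = (v 0 : ℝ) ^ 2 + (v 1 : ℝ) ^ 2 := Real.sq_sqrt hv2.le
  have hrne : r ≠ 0 := hrpos.ne'
  -- the orthonormal frame `n = v⊥/|v|`, `τ = v/|v|`
  set n : Fin 2 → ℝ := ![-(v 1 : ℝ) / r, (v 0 : ℝ) / r] with hn
  set τ : Fin 2 → ℝ := ![(v 0 : ℝ) / r, (v 1 : ℝ) / r] with hτ
  have hn0 : n 0 = -(v 1 : ℝ) / r := rfl
  have hn1' : n 1 = (v 0 : ℝ) / r := rfl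
  have hτ0 : τ 0 = (v 0 : ℝ) / r := rfl
  have hτ1' : τ 1 = (v 1 : ℝ) / r := rfl
  have hn1 : n 0 ^ 2 + n 1 ^ 2 = 1 := by
    rw [hn0, hn1']; field_simp; linarith [hrsq]
  have hτ1 : τ 0 ^ 2 + τ 1 ^ 2 = 1 := by
    rw [hτ0, hτ1']; field_simp; linarith [hrsq]
  have hnτ : n 0 * τ 0 + n 1 * τ 1 = 0 := by
    rw [hn0, hn1', hτ0, hτ1']; field_simp; ring
  -- transport to `ℤ²` through the centred coordinates
  set emb : TorusSite 2 L → ℤ × ℤ := fun z => ((z 0).valMinAbs, (z 1).valMinAbs) with hemb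
  have hinj : Set.InjOn emb S := by
    intro a _ b _ h
    have h' : (a 0).valMinAbs = (b 0).valMinAbs ∧ (a 1).valMinAbs = (b 1).valMinAbs := Prod.mk.inj h
    exact funext fun i => by
      fin_cases i
      · exact ZMod.injective_valMinAbs h'.1
      · exact ZMod.injective_valMinAbs h'.2
  have hmain := sum_inv_pow_frame_le (S.image emb) hn1 hτ1 hnτ (mul_pos hs₂ hrpos) (mul_pos hs₃ hrpos) hm
  rw [Finset.sum_image hinj] at hmain
  refine le_trans (le_of_eq (sum_congr rfl fun z _ => ?_)) hmain
  -- identify the summands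
  have e1 : (emb z).1 = (z 0).valMinAbs := rfl
  have e2 : (emb z).2 = (z 1).valMinAbs := rfl
  have k1 : r * ((((z 0).valMinAbs : ℤ) : ℝ) * n 0 + (((z 1).valMinAbs : ℤ) : ℝ) * n 1) =
      (-(v 1 : ℝ)) * (((z 0).valMinAbs : ℤ) : ℝ) + (v 0 : ℝ) * (((z 1).valMinAbs : ℤ) : ℝ) := by
    rw [hn0, hn1']; field_simp
  have k2 : r * ((((z 0).valMinAbs : ℤ) : ℝ) * τ 0 + (((z 1).valMinAbs : ℤ) : ℝ) * τ 1) =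
      (v 0 : ℝ) * (((z 0).valMinAbs : ℤ) : ℝ) + (v 1 : ℝ) * (((z 1).valMinAbs : ℤ) : ℝ) := by
    rw [hτ0, hτ1']; field_simp
  rw [e1, e2, ← k1, ← k2, abs_mul, abs_mul, abs_of_pos hrpos]
  ring

/-- **The near region, pointwise**: if `|z̃ᵢ| ≤ R₀` for both coordinates and `2(|v₁|+|v₂|)R₀ < L`, the decay variables
`ã_{v⊥}(z)`, `ã_v(z)` are the frame coordinates `v⊥·z̃`, `v·z̃`. [folklore] -/
theorem valMinAbs_frame_eq_of_near {L : ℕ} [NeZero L] (v : Fin 2 → ℤ) {R₀ : ℕ} (hR₀ : 2 * (|v 0| + |v 1|) * (R₀ : ℤ) < L)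
    (z : TorusSite 2 L) (hz : ∀ i, |((z i).valMinAbs : ℤ)| ≤ R₀) :
    (((∑ j, ((![-v 1, v 0] j : ℤ) : ZMod L) * z j).valMinAbs : ℤ) : ℝ) =
        (-(v 1 : ℝ)) * (((z 0).valMinAbs : ℤ) : ℝ) + (v 0 : ℝ) * (((z 1).valMinAbs : ℤ) : ℝ) ∧
      (((∑ j, ((v j : ℤ) : ZMod L) * z j).valMinAbs : ℤ) : ℝ) =
        (v 0 : ℝ) * (((z 0).valMinAbs : ℤ) : ℝ) + (v 1 : ℝ) * (((z 1).valMinAbs : ℤ) : ℝ) := by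
  have hlin : ∀ w : Fin 2 → ℤ, |w 0| + |w 1| ≤ |v 0| + |v 1| →
      (((∑ j, ((w j : ℤ) : ZMod L) * z j).valMinAbs : ℤ) : ℝ) = (w 0 : ℝ) * (((z 0).valMinAbs : ℤ) : ℝ) +
        (w 1 : ℝ) * (((z 1).valMinAbs : ℤ) : ℝ) := by
    intro w hw
    have hnr : 2 * |∑ j, w j * (z j).valMinAbs| < L := by
      refine two_mul_abs_sum_mul_valMinAbs_lt_of_norm w z hz (lt_of_le_of_lt ?_ hR₀)
      have hR0 : (0 : ℤ) ≤ R₀ := Int.natCast_nonneg _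
      rw [Fin.sum_univ_two]
      nlinarith
    rw [valMinAbs_sum_intCast_mul_eq w z hnr, Fin.sum_univ_two]
    push_cast
    ring
  have hperp : |(![-v 1, v 0] : Fin 2 → ℤ) 0| + |(![-v 1, v 0] : Fin 2 → ℤ) 1| ≤ |v 0| + |v 1| := by
    simp [abs_neg, add_comm]
  refine ⟨?_, hlin v le_rfl⟩
  rw [hlin _ hperp]
  simp

/-! ### The assembled space-time sum -/

/-- The plane factor, pointwise, FAR region: if `R₀ ≤ a + b` (`0 ≤ R₀`) then
`(1 + s₁(a+b) + B)^{-(m-3)} ≤ (1+s₁R₀)^{-(m-6)} (1 + s₁(a+b))^{-3}` for any `B ≥ 0`, `m ≥ 6`. [folklore] -/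
theorem inv_pow_plane_far_le {s₁ a b B : ℝ} (hs₁ : 0 < s₁) (ha : 0 ≤ a) (hb : 0 ≤ b) (hB : 0 ≤ B) {R₀ : ℝ}
    (hR0 : 0 ≤ R₀) (hR : R₀ ≤ a + b) {m : ℕ} (hm : 6 ≤ m) :
    (1 + s₁ * (a + b) + B)⁻¹ ^ (m - 3) ≤ (1 + s₁ * R₀)⁻¹ ^ (m - 6) * (1 + s₁ * (a + b))⁻¹ ^ 3 := by
  have hab : 0 ≤ s₁ * (a + b) := by positivity
  have hR' : s₁ * R₀ ≤ s₁ * (a + b) := mul_le_mul_of_nonneg_left hR hs₁.le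
  have hsR : 0 ≤ s₁ * R₀ := by positivity
  exact inv_pow_le_inv_pow_mul (by linarith) (by linarith) (by linarith) (by linarith) (by omega)

/-- **The plane factor summed** (near region through the frame, far region through the isotropic tail): for
`v ≠ 0`, `2(|v₁|+|v₂|)R₀ < L`, `m ≥ 6`,
`Σ_z (1 + s₁(|z̃₁|+|z̃₂|) + s₂|ã_{v⊥}(z)| + s₃|ã_v(z)|)^{-(m-3)} ≤ 8(2√2/(s₂|v|)+2)(2√2/(s₃|v|)+2) + (1+s₁R₀)^{-(m-6)} 32(1/s₁+1)²`.
[folklore] -/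
theorem sum_inv_pow_plane_le {L : ℕ} [NeZero L] (v : Fin 2 → ℤ) (hv : v ≠ 0) {s₁ s₂ s₃ : ℝ} (hs₁ : 0 < s₁)
    (hs₂ : 0 < s₂) (hs₃ : 0 < s₃) {R₀ : ℕ} (hR₀ : 2 * (|v 0| + |v 1|) * (R₀ : ℤ) < L) {m : ℕ} (hm : 6 ≤ m) :
    ∑ z : TorusSite 2 L,
      (1 + s₁ * (|(((z 0).valMinAbs : ℤ) : ℝ)| + |(((z 1).valMinAbs : ℤ) : ℝ)|)
        + (s₂ * |(((∑ j, ((![-v 1, v 0] j : ℤ) : ZMod L) * z j).valMinAbs : ℤ) : ℝ)|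
          + s₃ * |(((∑ j, ((v j : ℤ) : ZMod L) * z j).valMinAbs : ℤ) : ℝ)|))⁻¹ ^ (m - 3) ≤
      8 * ((2 * Real.sqrt 2 / (s₂ * Real.sqrt ((v 0 : ℝ) ^ 2 + (v 1 : ℝ) ^ 2)) + 2) *
          (2 * Real.sqrt 2 / (s₃ * Real.sqrt ((v 0 : ℝ) ^ 2 + (v 1 : ℝ) ^ 2)) + 2))
        + (1 + s₁ * R₀)⁻¹ ^ (m - 6) * (32 * (1 / s₁ + 1) ^ 2) := by
  classical
  rw [← sum_filter_add_sum_filter_not univ (fun z : TorusSite 2 L => ∀ i, |((z i).valMinAbs : ℤ)| ≤ R₀)]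
  refine add_le_add ?_ ?_
  · -- near region
    refine le_trans (sum_le_sum fun z hz => ?_)
      (sum_inv_pow_torus_near_le (univ.filter fun z : TorusSite 2 L => ∀ i, |((z i).valMinAbs : ℤ)| ≤ R₀) v hv hs₂ hs₃ le_rfl)
    have hzR : ∀ i, |((z i).valMinAbs : ℤ)| ≤ R₀ := (mem_filter.1 hz).2
    obtain ⟨e1, e2⟩ := valMinAbs_frame_eq_of_near v hR₀ z hzR
    rw [e1, e2]
    refine inv_pow_le_inv_pow_of_le ?_ ?_ (by omega)
    · linarith [mul_nonneg hs₂.le (abs_nonneg ((-(v 1 : ℝ)) * (((z 0).valMinAbs : ℤ) : ℝ) + (v 0 : ℝ) * (((z 1).valMinAbs : ℤ) : ℝ))),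
        mul_nonneg hs₃.le (abs_nonneg ((v 0 : ℝ) * (((z 0).valMinAbs : ℤ) : ℝ) + (v 1 : ℝ) * (((z 1).valMinAbs : ℤ) : ℝ)))]
    · linarith [mul_nonneg hs₁.le (add_nonneg (abs_nonneg (((z 0).valMinAbs : ℤ) : ℝ)) (abs_nonneg (((z 1).valMinAbs : ℤ) : ℝ)))]
  · -- far region
    calc ∑ z ∈ univ.filter (fun z : TorusSite 2 L => ¬ ∀ i, |((z i).valMinAbs : ℤ)| ≤ R₀),
          (1 + s₁ * (|(((z 0).valMinAbs : ℤ) : ℝ)| + |(((z 1).valMinAbs : ℤ) : ℝ)|)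
            + (s₂ * |(((∑ j, ((![-v 1, v 0] j : ℤ) : ZMod L) * z j).valMinAbs : ℤ) : ℝ)|
              + s₃ * |(((∑ j, ((v j : ℤ) : ZMod L) * z j).valMinAbs : ℤ) : ℝ)|))⁻¹ ^ (m - 3)
        ≤ ∑ z ∈ univ.filter (fun z : TorusSite 2 L => ¬ ∀ i, |((z i).valMinAbs : ℤ)| ≤ R₀),
            (1 + s₁ * R₀)⁻¹ ^ (m - 6) * (1 + s₁ * (|(((z 0).valMinAbs : ℤ) : ℝ)| + |(((z 1).valMinAbs : ℤ) : ℝ)|))⁻¹ ^ 3 := by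
          refine sum_le_sum fun z hz => ?_
          have hz' : ¬ ∀ i, |((z i).valMinAbs : ℤ)| ≤ R₀ := (mem_filter.1 hz).2
          push Not at hz'
          obtain ⟨i, hi⟩ := hz'
          have hi' : (R₀ : ℝ) < |(((z i).valMinAbs : ℤ) : ℝ)| := by
            rw [← Int.cast_abs]; exact_mod_cast hi
          have hsum : |(((z i).valMinAbs : ℤ) : ℝ)| ≤ |(((z 0).valMinAbs : ℤ) : ℝ)| + |(((z 1).valMinAbs : ℤ) : ℝ)| := by
            have h := Finset.single_le_sum (f := fun i : Fin 2 => |(((z i).valMinAbs : ℤ) : ℝ)|) (fun j _ => abs_nonneg _)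
              (mem_univ i)
            rwa [Fin.sum_univ_two] at h
          exact inv_pow_plane_far_le hs₁ (abs_nonneg _) (abs_nonneg _) (by positivity) (Nat.cast_nonneg R₀) (by linarith) hm
      _ ≤ ∑ z : TorusSite 2 L, (1 + s₁ * R₀)⁻¹ ^ (m - 6) *
            (1 + s₁ * (|(((z 0).valMinAbs : ℤ) : ℝ)| + |(((z 1).valMinAbs : ℤ) : ℝ)|))⁻¹ ^ 3 :=
          sum_le_univ_sum_of_nonneg fun z => by positivity
      _ ≤ (1 + s₁ * R₀)⁻¹ ^ (m - 6) * (32 * (1 / s₁ + 1) ^ 2) := by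
          rw [← mul_sum]
          exact mul_le_mul_of_nonneg_left (sum_inv_pow_torus_l1_le hs₁ le_rfl) (by positivity)

/-- **The `L¹` volume of an anisotropic decay factor on the space-time torus** `(ℤ/Pℤ)¹ × (ℤ/Lℤ)²`: for an integer
vector `v ≠ 0` with `v⊥ = (-v₂, v₁)`, rates `s₀, s₁, s₂, s₃ > 0`, a near radius `R₀` with `2(|v₁|+|v₂|)R₀ < L`, and
`m ≥ 6`,
`Σ_{(j,z)} (1 + s₀|j̃| + s₁(|z̃₁|+|z̃₂|) + s₂|ã_{v⊥}(z)| + s₃|ã_v(z)|)^{-m}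
   ≤ 32(1/s₀+1) · [8(2√2/(s₂|v|)+2)(2√2/(s₃|v|)+2) + (1+s₁R₀)^{-(m-6)} · 32(1/s₁+1)²]`,
`ã_w(z) = valMinAbs (w₁z₁ + w₂z₂)`.  Near points (`|z̃|_∞ ≤ R₀`) are summed through the rotated frame, where
`ã_w(z) = w·z̃`; far points through the isotropic factor, which is at most `(1+s₁R₀)^{-(m-6)}` there.
[cite: BenfattoGiulianiMastropietro2006, §2.6 (2.81) and footnote 1] -/
theorem sum_inv_pow_spaceTimeTorus_le {P L : ℕ} [NeZero P] [NeZero L] (v : Fin 2 → ℤ) (hv : v ≠ 0)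
    {s₀ s₁ s₂ s₃ : ℝ} (hs₀ : 0 < s₀) (hs₁ : 0 < s₁) (hs₂ : 0 < s₂) (hs₃ : 0 < s₃) {R₀ : ℕ}
    (hR₀ : 2 * (|v 0| + |v 1|) * (R₀ : ℤ) < L) {m : ℕ} (hm : 6 ≤ m) :
    ∑ q : TorusSite 1 P × TorusSite 2 L,
      (1 + s₀ * |(((q.1 0).valMinAbs : ℤ) : ℝ)| + s₁ * (|(((q.2 0).valMinAbs : ℤ) : ℝ)| + |(((q.2 1).valMinAbs : ℤ) : ℝ)|)
        + s₂ * |(((∑ j, ((![-v 1, v 0] j : ℤ) : ZMod L) * q.2 j).valMinAbs : ℤ) : ℝ)|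
        + s₃ * |(((∑ j, ((v j : ℤ) : ZMod L) * q.2 j).valMinAbs : ℤ) : ℝ)|)⁻¹ ^ m ≤
      32 * (1 / s₀ + 1) *
        (8 * ((2 * Real.sqrt 2 / (s₂ * Real.sqrt ((v 0 : ℝ) ^ 2 + (v 1 : ℝ) ^ 2)) + 2) *
            (2 * Real.sqrt 2 / (s₃ * Real.sqrt ((v 0 : ℝ) ^ 2 + (v 1 : ℝ) ^ 2)) + 2))
          + (1 + s₁ * R₀)⁻¹ ^ (m - 6) * (32 * (1 / s₁ + 1) ^ 2)) := by
  -- the time factor and the plane factor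
  let T : TorusSite 1 P → ℝ := fun j => (1 + s₀ * |(((j 0).valMinAbs : ℤ) : ℝ)|)⁻¹ ^ 3
  let X : TorusSite 2 L → ℝ := fun z =>
    (1 + s₁ * (|(((z 0).valMinAbs : ℤ) : ℝ)| + |(((z 1).valMinAbs : ℤ) : ℝ)|)
      + (s₂ * |(((∑ j, ((![-v 1, v 0] j : ℤ) : ZMod L) * z j).valMinAbs : ℤ) : ℝ)|
        + s₃ * |(((∑ j, ((v j : ℤ) : ZMod L) * z j).valMinAbs : ℤ) : ℝ)|))⁻¹ ^ (m - 3)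
  have hT0 : ∀ j, 0 ≤ T j := fun j => by positivity
  have hX0 : ∀ z, 0 ≤ X z := fun z => by positivity
  -- (1) pointwise split
  have hsplit : ∀ q : TorusSite 1 P × TorusSite 2 L,
      (1 + s₀ * |(((q.1 0).valMinAbs : ℤ) : ℝ)| + s₁ * (|(((q.2 0).valMinAbs : ℤ) : ℝ)| + |(((q.2 1).valMinAbs : ℤ) : ℝ)|)
        + s₂ * |(((∑ j, ((![-v 1, v 0] j : ℤ) : ZMod L) * q.2 j).valMinAbs : ℤ) : ℝ)|
        + s₃ * |(((∑ j, ((v j : ℤ) : ZMod L) * q.2 j).valMinAbs : ℤ) : ℝ)|)⁻¹ ^ m ≤ T q.1 * X q.2 := by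
    intro q
    have h0 : 0 ≤ s₀ * |(((q.1 0).valMinAbs : ℤ) : ℝ)| := by positivity
    have h1 : 0 ≤ s₁ * (|(((q.2 0).valMinAbs : ℤ) : ℝ)| + |(((q.2 1).valMinAbs : ℤ) : ℝ)|) := by positivity
    have h2 : 0 ≤ s₂ * |(((∑ j, ((![-v 1, v 0] j : ℤ) : ZMod L) * q.2 j).valMinAbs : ℤ) : ℝ)| := by positivity
    have h3 : 0 ≤ s₃ * |(((∑ j, ((v j : ℤ) : ZMod L) * q.2 j).valMinAbs : ℤ) : ℝ)| := by positivity
    exact inv_pow_le_inv_pow_mul (by linarith) (by linarith) (by linarith) (by linarith) (by omega)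
  -- (2) assemble
  calc ∑ q : TorusSite 1 P × TorusSite 2 L, _
      ≤ ∑ q : TorusSite 1 P × TorusSite 2 L, T q.1 * X q.2 := sum_le_sum fun q _ => hsplit q
    _ = (∑ j, T j) * ∑ z, X z := by rw [Fintype.sum_prod_type, sum_mul_sum]
    _ ≤ (32 * (1 / s₀ + 1)) * _ :=
        mul_le_mul (sum_inv_pow_cyclic_le hs₀ le_rfl) (sum_inv_pow_plane_le v hv hs₁ hs₂ hs₃ hR₀ hm)
          (sum_nonneg fun z _ => hX0 z) (by positivity)

end Literature.Probability.LatticeModels
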